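import Mathlib.CategoryTheory.Equivalence
import Mathlib.CategoryTheory.Functor.EpiMono
import Mathlib.CategoryTheory.Adjunction.Limits
import Literature.AlgebraicGeometry.Frobenioids.CategoriesFactorization
import HarnessLib

/-!
# Frobenioids I, §0/§3: the §0 classes of arrows are preserved by equivalences of categories

Mochizuki, *The geometry of Frobenioids I* (2008). The proofs of Thm. 3.4 (i), (ii) and Prop. 3.11 (ii)
use, without comment beyond the word "manifestly", that an equivalence of categories `Ψ : C₁ ⥲ C₂`
preserves the purely category-theoretic notions of §0: "iso-subanchors are manifestly preserved by any
equivalence of categories" (proof of Thm. 3.4 (i), p. 63), "[since any equivalence of categories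
manifestly preserves FSM-morphisms and irreducible morphisms]" (proof of Thm. 3.4 (ii), p. 63)
[cite: MochizukiFrdI2008, Thm. 3.4 proof p.63]. This file PROVES these transport statements for the
notions of `Categories.lean` / `CategoriesFactorization.lean`: isomorphisms (reflected), irreducible
arrows, fiberwise-surjective arrows, FSM- and FSMI-morphisms, and categorical quotients by a group of
automorphisms (with the group transported by `Functor.mapAut`). They are the first steps of the proofs of
Thm. 3.4 (i)/(ii) over the cell's Definition 1.3. Anchors / subanchors / iso-subanchors (finiteness of
isomorphism classes in `^A C`, mono-minimality) are NOT yet here. No statement of the paper is involved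
beyond these formal transports.
-/

namespace Literature.AlgebraicGeometry.Frobenioids

open CategoryTheory

universe v₁ v₂ u₁ u₂

variable {C : Type u₁} [Category.{v₁} C] {D : Type u₂} [Category.{v₂} D] (e : C ≌ D)

/-! ### Pulling a factorisation in `D` back to `C` -/

/-- An arrow `e(A) → X'` of `D` is, up to the isomorphism `X' ≅ e(e⁻¹ X')`, the image of an arrow of `C`.
[cite: MochizukiFrdI2008, Thm. 3.4 proof p.63] -/
theorem exists_preimage_from {A : C} {X' : D} (β' : e.functor.obj A ⟶ X') :
    ∃ β : A ⟶ e.functor.objPreimage X',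
      e.functor.map β = β' ≫ (e.functor.objObjPreimageIso X').inv :=
  ⟨e.functor.preimage (β' ≫ (e.functor.objObjPreimageIso X').inv), e.functor.map_preimage _⟩

/-- An arrow `X' → e(B)` of `D` is, up to `X' ≅ e(e⁻¹ X')`, the image of an arrow of `C`.
[cite: MochizukiFrdI2008, Thm. 3.4 proof p.63] -/
theorem exists_preimage_to {B : C} {X' : D} (α' : X' ⟶ e.functor.obj B) :
    ∃ α : e.functor.objPreimage X' ⟶ B,
      e.functor.map α = (e.functor.objObjPreimageIso X').hom ≫ α' :=
  ⟨e.functor.preimage ((e.functor.objObjPreimageIso X').hom ≫ α'), e.functor.map_preimage _⟩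

/-! ### Isomorphisms and irreducible arrows -/

/-- An equivalence reflects isomorphisms. [cite: MochizukiFrdI2008, Thm. 3.4 proof p.63] -/
theorem isIso_of_map_isIso_equivalence {A B : C} (f : A ⟶ B) (h : IsIso (e.functor.map f)) : IsIso f :=
  isIso_of_fully_faithful e.functor f

/-- "Any equivalence of categories manifestly preserves … irreducible morphisms" (FrdI p. 63; PROVED).
[cite: MochizukiFrdI2008, Thm. 3.4 proof p.63] -/
theorem IsIrreducibleHom.map_equivalence {A B : C} {f : A ⟶ B} (hf : IsIrreducibleHom f) :
    IsIrreducibleHom (e.functor.map f) := by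
  refine ⟨fun h => hf.1 (isIso_of_map_isIso_equivalence e f h), fun X' β' α' hfac => ?_⟩
  obtain ⟨β, hβ⟩ := exists_preimage_from e β'
  obtain ⟨α, hα⟩ := exists_preimage_to e α'
  have hcomp : β ≫ α = f := e.functor.map_injective (by
    rw [Functor.map_comp, hβ, hα, Category.assoc, Iso.inv_hom_id_assoc, hfac])
  rcases hf.2 β α hcomp with hα' | hβ'
  · left
    have : IsIso (e.functor.map α) := inferInstance
    rw [hα] at this
    exact IsIso.of_isIso_comp_left (e.functor.objObjPreimageIso X').hom α'
  · right
    have : IsIso (e.functor.map β) := inferInstance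
    rw [hβ] at this
    exact IsIso.of_isIso_comp_right β' (e.functor.objObjPreimageIso X').inv

/-! ### Fiberwise-surjective arrows, FSM- and FSMI-morphisms -/

/-- An equivalence preserves fiberwise-surjective arrows (FrdI §0 p. 14; p. 63 "manifestly").
[cite: MochizukiFrdI2008, Thm. 3.4 proof p.63] -/
theorem IsFiberwiseSurjective.map_equivalence {B A : C} {β : B ⟶ A} (hβ : IsFiberwiseSurjective β) :
    IsFiberwiseSurjective (e.functor.map β) := by
  intro X' γ'
  obtain ⟨γ, hγ⟩ := exists_preimage_to e γ'
  obtain ⟨D₀, δB, δX, h⟩ := hβ γ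
  refine ⟨e.functor.obj D₀, e.functor.map δB, e.functor.map δX ≫ (e.functor.objObjPreimageIso X').hom, ?_⟩
  rw [← Functor.map_comp, h, Functor.map_comp, hγ, Category.assoc]

/-- "Any equivalence of categories manifestly preserves FSM-morphisms" (FrdI p. 63; PROVED).
[cite: MochizukiFrdI2008, Thm. 3.4 proof p.63] -/
theorem IsFSM.map_equivalence {B A : C} {β : B ⟶ A} (hβ : IsFSM β) : IsFSM (e.functor.map β) := by
  haveI := hβ.2
  exact ⟨hβ.1.map_equivalence e, inferInstance⟩

/-- An equivalence preserves FSMI-morphisms (irreducible FSM-morphisms).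
[cite: MochizukiFrdI2008, Thm. 3.4 proof p.63] -/
theorem IsFSMI.map_equivalence {B A : C} {β : B ⟶ A} (hβ : IsFSMI β) : IsFSMI (e.functor.map β) :=
  ⟨hβ.1.map_equivalence e, hβ.2.map_equivalence e⟩

/-! ### Categorical quotients by groups of automorphisms -/

/-- An equivalence carries a categorical quotient `φ : A → B` of `A` by `G ⊆ Aut(A)` to a categorical
quotient of `Ψ(A)` by the transported group `Ψ(G) ⊆ Aut(Ψ A)` (FrdI §0 p. 18; transport used in the proof
of Thm. 3.4 (i), p. 63). [cite: MochizukiFrdI2008, Thm. 3.4 proof p.63] -/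
theorem IsCategoricalQuotient.map_equivalence {A B : C} {G : Subgroup (Aut A)} {φ : A ⟶ B}
    (h : IsCategoricalQuotient G φ) :
    IsCategoricalQuotient (G.map (e.functor.mapAut A)) (e.functor.map φ) := by
  refine ⟨?_, fun X' ψ' hψ' => ?_⟩
  · rintro γ' ⟨γ, hγ, rfl⟩
    show (e.functor.mapIso γ).hom ≫ e.functor.map φ = e.functor.map φ
    rw [Functor.mapIso_hom, ← Functor.map_comp, h.1 γ hγ]
  · obtain ⟨ψ, hψ⟩ := exists_preimage_from e ψ'
    have hinv : ∀ γ ∈ G, γ.hom ≫ ψ = ψ := fun γ hγ => e.functor.map_injective (by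
      have hγ' : (e.functor.mapIso γ).hom ≫ ψ' = ψ' := hψ' _ ⟨γ, hγ, rfl⟩
      rw [Functor.map_comp, hψ, ← Category.assoc, ← Functor.mapIso_hom, hγ'])
    obtain ⟨ψ₁, hψ₁, huniq⟩ := h.2 ψ hinv
    refine ⟨e.functor.map ψ₁ ≫ (e.functor.objObjPreimageIso X').hom, ?_, fun χ' hχ' => ?_⟩
    · show e.functor.map φ ≫ e.functor.map ψ₁ ≫ (e.functor.objObjPreimageIso X').hom = ψ'
      rw [← Category.assoc, ← Functor.map_comp, hψ₁, hψ, Category.assoc, Iso.inv_hom_id, Category.comp_id]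
    · obtain ⟨χ, hχ⟩ := exists_preimage_from e χ'
      have hχφ : φ ≫ χ = ψ := e.functor.map_injective (by
        rw [Functor.map_comp, hχ, hψ, ← Category.assoc, hχ'])
      rw [← huniq χ hχφ, hχ, Category.assoc, Iso.inv_hom_id, Category.comp_id]

end Literature.AlgebraicGeometry.Frobenioids
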